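import Mathlib
import Summits.QuantumFields.YangMills.Theses.QuantileBitPurity

/-!
# `QuantileBitPurity.Assembly` — the window/tail stitch of LINE g12-B (ym-idea-4)

Closes the assembly item of route `QuantileBitPurity`: a purity deficit
`Z_phys(2L) ≤ (1 - β^{-k}) Z_phys(L)^2` on SOME window `L ≤ β^a` together with the residual
polynomial tail `β^a ≤ L ≤ β^A` (crux `PurityDeficitPolyTail`) gives
`ThermalTraceWindow.SubFemtoTraceRatio` (K2) on every window `L ≤ β^A`.
Given `A`, take the window's `a, (k₁, β₁, L₁)` and the tail's `(k₂, β₂, L₂)` at `(a, A)`; use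
`k = max k₁ k₂`, `β₀ = max (max β₁ β₂) 1`, `L₀ = max L₁ L₂`; case split on `L ≤ β^a`;
monotonicity of `1 - β^{-k}` in `k` for `β ≥ 1` times `Z_phys(L)^2 ≥ 0`.
Pure bookkeeping (pattern of `SwapTwistDeficit.twistDeficit_of_window_of_tail`); no summit content.
-/

set_option autoImplicit false

noncomputable section

open Summit.QuantumFields.YangMills.Theorems.FemtoTransferGap

namespace Summit.QuantumFields.YangMills.Theorems.QuantileBitPurity

open Summit.QuantumFields.YangMills.Theses.QuantileBitPurity

/-- Window ∧ tail ⇒ K2 (`ThermalTraceWindow.SubFemtoTraceRatio`). -/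
theorem subFemtoTraceRatio_of_window_of_tail
    (hW : ∃ a : ℝ, 0 < a ∧ ∃ k β₀ : ℝ, ∃ L₀ : ℕ, ∀ β : ℝ, β₀ ≤ β → ∀ (L : ℕ) [NeZero L], L₀ ≤ L →
      (L : ℝ) ≤ β ^ a → TT.physTrace L β (2 * L) ≤ (1 - β ^ (-k)) * TT.physTrace L β L ^ 2)
    (hP : PurityDeficitPolyTail) :
    Summit.QuantumFields.YangMills.Theses.ThermalTraceWindow.SubFemtoTraceRatio := by
  intro A hA
  obtain ⟨a, ha, k₁, β₁, L₁, h₁⟩ := hW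
  obtain ⟨k₂, β₂, L₂, h₂⟩ := hP a ha A hA
  refine ⟨max k₁ k₂, max (max β₁ β₂) 1, max L₁ L₂, ?_⟩
  intro β hβ L _ hL hLA
  have hβ1 : 1 ≤ β := le_trans (le_max_right _ _) hβ
  have hβ₁ : β₁ ≤ β := le_trans (le_trans (le_max_left _ _) (le_max_left _ _)) hβ
  have hβ₂ : β₂ ≤ β := le_trans (le_trans (le_max_right _ _) (le_max_left _ _)) hβ
  have hL₁ : L₁ ≤ L := le_trans (le_max_left _ _) hL
  have hL₂ : L₂ ≤ L := le_trans (le_max_right _ _) hL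
  have hZ : 0 ≤ TT.physTrace L β L ^ 2 := sq_nonneg _
  have key : ∀ k' : ℝ, k' ≤ max k₁ k₂ →
      TT.physTrace L β (2 * L) ≤ (1 - β ^ (-k')) * TT.physTrace L β L ^ 2 →
      TT.physTrace L β (2 * L) ≤ (1 - β ^ (-(max k₁ k₂))) * TT.physTrace L β L ^ 2 := by
    intro k' hk' h
    refine le_trans h ?_
    apply mul_le_mul_of_nonneg_right _ hZ
    have : β ^ (-(max k₁ k₂)) ≤ β ^ (-k') := Real.rpow_le_rpow_of_exponent_le hβ1 (by linarith)
    linarith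
  rcases le_total (L : ℝ) (β ^ a) with hLa | hLa
  · exact key k₁ (le_max_left _ _) (h₁ β hβ₁ L hL₁ hLa)
  · exact key k₂ (le_max_right _ _) (h₂ β hβ₂ L hL₂ hLa hLA)

/-- The assembly item `QuantileBitPurity.Assembly` holds. -/
theorem assembly : Assembly :=
  fun hW hP => subFemtoTraceRatio_of_window_of_tail hW hP

end Summit.QuantumFields.YangMills.Theorems.QuantileBitPurity

end
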